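import Literature.MathematicalPhysics.QuantumFieldTheory.Balaban1983to89.Node00.HistoryAdmissibleClass

/-!
# `Balaban1983to89.B13OlderTermsTableGerms` — T. Bałaban, *Renormalization group approach to lattice gauge field theories. I*, Commun. Math. Phys.
**109** (1987) 249–301 [Balaban1987RG1] §1 p. 263 with (1.18), and *… II. Cluster expansions*, Commun. Math. Phys. **116** (1988) 1–22
[Balaban1988RG2Cluster] (1.41) p. 11, (2.14) p. 15: THE NORMED SPACE OF BOUNDED ANALYTIC TABLE GERMS OF THE OLDER TERMS — the canonical Banach-type
reading `(Pot, ρ, cv)` of the older-term table `(E^{(j)}(Y; ·))_{j ≤ k}` on the small-field tables, with the weighted sup norm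

statement-level skeleton of published theorems with citation tags; proofs where landed; nothing here is a claim about the Yang–Mills mass gap

CITATION HEADER.  [I] §1 p. 263: the inductive hypothesis — every older term `E^{(j)}(X; 𝐔, 𝐉)`, `j ≤ k`, is «defined and analytic on the space
U^c_j(X, α₀, α₁)» and satisfies (1.18) `|E^{(j)}(X)| ≤ E₀ e^{−κ d_j(X)}` there; [II] (1.41) p. 11 and (2.14) p. 15: the new term reads the older terms through
Lemma 2's potentials `𝐕_k(Y, ·)`, i.e. through their VALUES ON THE TABLES.  This module types the obvious normed space in which such a table lives and
through which a function of the older terms «holomorphic in the history» can be read: the weighted tables `(j, Y, ψ) ↦ b_j·e^{κ d_j(Y)}·E^{(j)}(Y; ψ)`,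
`ψ ∈ sp j Y`, bounded (sup norm, Mathlib `lp … ∞`) and ANALYTIC ON THE TABLES germ by germ.

WHY (cell `pub-ymgap`, Track A, seat `pub-ymgap-dag-n10-c` g19; count-neutral).  The Summit-side N22 ROAD-2 binder (AR) (`…N22AtRecordOfGenAnalyticReading`
§1: `hGA hA hMbA hAdmr hρ₁ hρ₂`) reads def-W1's one-step map through an ABSTRACT reading `ρ : OlderTerms → Pot` into a complex normed space; the N10 modules
101∕102∕104 (`…N10GenAnalyticReadingOfActivities`, `…OfTermwise226`, `…N10OlderTermsBanachSection`) produce the generator-side rows from activity∕term-level data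
along an ABSTRACT section `cv : Pot → OlderTerms` with three axioms (R1) tables ∕ (R2) linear-bounded ∕ (R3) analytic.  THIS FILE supplies the CONCRETE carrier
for which the reading-side rows and the axioms are THEOREMS:
* §1 `TIdx k sp` (indices `(j, Y, ψ)`, `ψ ∈ sp j Y`), `wt κ bw j Y = bw j·e^{κ d_j(Y)}` (positive level weights `bw`), `table` (the weighted table of a family),
  `germ` (the clamped germ of a raw table at `(j, Y)`), ★ `germSpace k sp` — the ℂ-SUBMODULE of `lp (fun _ : TIdx k sp ↦ ℂ) ∞` of tables whose germs are analytic on the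
  tables — and `Pot k sp := ↥(germSpace k sp)` (a complex normed space by Mathlib's submodule instances; no `instance` is declared here);
* §2 the section `cv κ bw p : OlderTerms` (unweighted germs) with (R2) `cv_add`, `cv_smul` (EVERYWHERE, not only on the tables), `norm_cv_le` (`‖cv p _j Y ψ‖ ≤ (min_j bw)⁻¹‖p‖`
  for `κ ≥ 0`), (R3) `analyticOnNhd_cv`;
* §3 the reading `ρ sp κ bw old : Pot k sp` (the weighted table when bounded and table-analytic, else `0`) with `coe_ρ_of_admHist` (on [I] §1's admissible class
  `W1.AdmHist sp E₀ r₁ k`, `κ ≤ r₁`, the reading IS the table), (R1) `cv_ρ_eqOn_of_admHist`, (AR-adm) ★ `norm_ρ_le_of_admHist` (`‖ρ old‖ ≤ (max_j bw)·E₀`),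
  (AR-dom₁) ★ `norm_ρ_sub_ρ_le`, (AR-dom₂) ★ `norm_ρ_threePoint_le` (entrywise weighted domination ⟹ norm domination — the sup norm);
* §4 `norm_ρ_sub_ρ_le_succ`, `norm_ρ_threePoint_le_succ` — the same in the Summit-side rows' index form (levels `k′ + 1`, `k′ < k`; no level-`0` table, [I] (0.23)).
HONEST FRAMING.  Definitions + [folklore]-level bookkeeping over Mathlib's `lp` and def-W1's `W1.AdmHist`; NOTHING of [I]∕[II] is asserted; no estimate is proved;
N10 ∕ N22 NOT discharged; nothing continuum ∕ OS ∕ mass-gap ∕ Clay.  Typer lint: no `instance`, no `notation`, no attribute changes, 0 sorry.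
-/

noncomputable section

open Set Metric
open scoped BigOperators ENNReal

namespace Literature.MathematicalPhysics.QuantumFieldTheory.Balaban1983to89.B13OlderTermsTableGerms

open Literature.MathematicalPhysics.QuantumFieldTheory.Balaban1983to89
open Literature.MathematicalPhysics.QuantumFieldTheory.Balaban1983to89.Node00.Sect2 (domSys CPair)
open Literature.MathematicalPhysics.QuantumFieldTheory.Balaban1983to89.Node00.W1

variable {P : Params} {𝔸 : Type*} {M : ℕ} (k : ℕ) (sp : (j : ℕ) → (domSys P M j).Dom → Set (CPair P 𝔸))

/-! ## §1 Indices, weights, tables, germs; the germ space -/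

/-- **THE TABLE INDICES AT STEP `k`**: a level `j ≤ k`, a domain `Y ∈ 𝐃_j` and a point `ψ` of the table `sp j Y` (print's `U^c_j(Y, α₀, α₁)`).
[cite: Balaban1987RG1, §1 p.263 (the spaces U^c_j(X, α₀, α₁))] -/
def TIdx : Type _ := Σ j : Fin (k + 1), Σ Y : (domSys P M j).Dom, ↥(sp j Y)

variable (κ : ℝ) (bw : Fin (k + 1) → ℝ)

/-- **THE WEIGHT OF LEVEL `j`, DOMAIN `Y`**: `b_j·e^{κ d_j(Y)}` — the (1.18) decay read as a weight, times a positive level weight `b_j` (the age factors of the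
consumer's channels). [cite: Balaban1987RG1, (1.18) p.263] -/
def wt (j : Fin (k + 1)) (Y : (domSys P M j).Dom) : ℝ := bw j * Real.exp (κ * (domSys P M j).dj Y)

variable {k sp}

variable (sp) in
/-- **THE WEIGHTED TABLE OF AN OLDER-TERM FAMILY**: `(j, Y, ψ) ↦ b_j e^{κ d_j(Y)}·E^{(j)}(Y; ψ)`. [cite: Balaban1987RG1, (1.18) p.263] -/
def table (old : OlderTerms P 𝔸 M k) : TIdx k sp → ℂ := fun i => ((wt k κ bw i.1 i.2.1 : ℝ) : ℂ) * old i.1 i.2.1 i.2.2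

open Classical in
/-- **THE CLAMPED GERM OF A RAW TABLE AT `(j, Y)`**: the table's values on `sp j Y`, `0` off the table. [cite: Balaban1987RG1, §1 p.263 (functions on U^c_j)] -/
def germ (p : TIdx k sp → ℂ) (j : Fin (k + 1)) (Y : (domSys P M j).Dom) : CPair P 𝔸 → ℂ :=
  fun ψ => if h : ψ ∈ sp j Y then p ⟨j, Y, ⟨ψ, h⟩⟩ else 0

/-- Face: the germ on the table. [cite: Balaban1987RG1, §1 p.263 (bookkeeping)] -/
theorem germ_of_mem (p : TIdx k sp → ℂ) (j : Fin (k + 1)) (Y : (domSys P M j).Dom) {ψ : CPair P 𝔸} (h : ψ ∈ sp j Y) :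
    germ p j Y ψ = p ⟨j, Y, ⟨ψ, h⟩⟩ := by
  simp only [germ, dif_pos h]

/-- Face: the germ is additive in the table. [cite: Balaban1987RG1, §1 p.263 (bookkeeping)] -/
theorem germ_add (p q : TIdx k sp → ℂ) (j : Fin (k + 1)) (Y : (domSys P M j).Dom) : germ (p + q) j Y = germ p j Y + germ q j Y := by
  funext ψ
  by_cases h : ψ ∈ sp j Y
  · simp only [germ, dif_pos h, Pi.add_apply]
  · simp only [germ, dif_neg h, Pi.add_apply, add_zero]

/-- Face: the germ is homogeneous in the table. [cite: Balaban1987RG1, §1 p.263 (bookkeeping)] -/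
theorem germ_smul (a : ℂ) (p : TIdx k sp → ℂ) (j : Fin (k + 1)) (Y : (domSys P M j).Dom) : germ (a • p) j Y = a • germ p j Y := by
  funext ψ
  by_cases h : ψ ∈ sp j Y
  · simp only [germ, dif_pos h, Pi.smul_apply]
  · simp only [germ, dif_neg h, Pi.smul_apply, smul_zero]

/-- Face: the germ of the zero table. [cite: Balaban1987RG1, §1 p.263 (bookkeeping)] -/
theorem germ_zero (j : Fin (k + 1)) (Y : (domSys P M j).Dom) : germ (0 : TIdx k sp → ℂ) j Y = 0 := by
  funext ψ
  by_cases h : ψ ∈ sp j Y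
  · simp only [germ, dif_pos h]; rfl
  · simp only [germ, dif_neg h]; rfl

variable (k sp) in
/-- ★ **THE GERM SPACE**: the ℂ-submodule of the bounded tables `lp (TIdx k sp → ℂ) ∞` whose clamped germs are ANALYTIC ON THE TABLES at every `(j, Y)` — [I] §1 p. 263's
class «defined and analytic on U^c_j(X, α₀, α₁)» ∧ bounded, as a normed space (weighted sup norm). [cite: Balaban1987RG1, §1 p.263 with (1.18)] -/
def germSpace [NormedRing 𝔸] [NormedAlgebra ℂ 𝔸] : Submodule ℂ (lp (fun _ : TIdx k sp => ℂ) ∞) where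
  carrier := {p | ∀ (j : Fin (k + 1)) (Y : (domSys P M j).Dom), AnalyticOnNhd ℂ (germ (p : TIdx k sp → ℂ) j Y) (sp j Y)}
  zero_mem' := by
    intro j Y
    have h0 : germ ((0 : lp (fun _ : TIdx k sp => ℂ) ∞) : TIdx k sp → ℂ) j Y = 0 := by
      rw [lp.coeFn_zero]; exact germ_zero j Y
    rw [h0]
    exact analyticOnNhd_const
  add_mem' := by
    intro p q hp hq j Y
    have h : germ ((p + q : lp (fun _ : TIdx k sp => ℂ) ∞) : TIdx k sp → ℂ) j Y =
        germ (p : TIdx k sp → ℂ) j Y + germ (q : TIdx k sp → ℂ) j Y := by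
      rw [lp.coeFn_add]; exact germ_add _ _ j Y
    rw [h]
    exact (hp j Y).add (hq j Y)
  smul_mem' := by
    intro a p hp j Y
    have h : germ ((a • p : lp (fun _ : TIdx k sp => ℂ) ∞) : TIdx k sp → ℂ) j Y = a • germ (p : TIdx k sp → ℂ) j Y := by
      rw [lp.coeFn_smul]; exact germ_smul a _ j Y
    rw [h]
    exact (hp j Y).const_smul

variable (k sp) in
/-- **THE CARRIER `Pot k sp`**: the germ space as a type (complex normed space by the submodule structure). [cite: Balaban1987RG1, §1 p.263 with (1.18)] -/
abbrev Pot [NormedRing 𝔸] [NormedAlgebra ℂ 𝔸] : Type _ := ↥(germSpace k sp)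

/-! ## §2 The section `cv : Pot → OlderTerms` — axioms (R2), (R3) of the N10 modules as theorems -/
section Section

variable [NormedRing 𝔸] [NormedAlgebra ℂ 𝔸]

/-- **THE SECTION**: a germ table read back as an older-term family — the unweighted germs (`0` off the tables). [cite: Balaban1987RG1, §1 p.263; Balaban1988RG2Cluster, (1.41) p.11] -/
def cv (p : Pot k sp) : OlderTerms P 𝔸 M k :=
  fun j Y ψ => (((wt k κ bw j Y : ℝ) : ℂ))⁻¹ * germ ((p : lp (fun _ : TIdx k sp => ℂ) ∞) : TIdx k sp → ℂ) j Y ψ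

/-- Face: the section unfolded. [cite: Balaban1987RG1, §1 p.263 (bookkeeping)] -/
theorem cv_apply (p : Pot k sp) (j : Fin (k + 1)) (Y : (domSys P M j).Dom) (ψ : CPair P 𝔸) :
    cv κ bw p j Y ψ = (((wt k κ bw j Y : ℝ) : ℂ))⁻¹ * germ ((p : lp (fun _ : TIdx k sp => ℂ) ∞) : TIdx k sp → ℂ) j Y ψ := rfl

/-- **(R2, additivity)** — everywhere, not only on the tables. [cite: Balaban1987RG1, §1 p.263 (bookkeeping)] -/
theorem cv_add (p q : Pot k sp) (j : Fin (k + 1)) (Y : (domSys P M j).Dom) (ψ : CPair P 𝔸) :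
    cv κ bw (p + q) j Y ψ = cv κ bw p j Y ψ + cv κ bw q j Y ψ := by
  simp only [cv_apply, Submodule.coe_add, lp.coeFn_add, germ_add, Pi.add_apply, mul_add]

/-- **(R2, homogeneity)** — everywhere. [cite: Balaban1987RG1, §1 p.263 (bookkeeping)] -/
theorem cv_smul (a : ℂ) (p : Pot k sp) (j : Fin (k + 1)) (Y : (domSys P M j).Dom) (ψ : CPair P 𝔸) :
    cv κ bw (a • p) j Y ψ = a * cv κ bw p j Y ψ := by
  simp only [cv_apply, Submodule.coe_smul, lp.coeFn_smul, germ_smul, Pi.smul_apply, smul_eq_mul]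
  ring

/-- **(R3)**: every section is ANALYTIC ON THE TABLES (by membership in the germ space). [cite: Balaban1987RG1, §1 p.263] -/
theorem analyticOnNhd_cv (p : Pot k sp) (j : Fin (k + 1)) (Y : (domSys P M j).Dom) : AnalyticOnNhd ℂ (cv κ bw p j Y) (sp j Y) :=
  analyticOnNhd_const.mul (p.2 j Y)

/-- The weights are at least the level weights for `κ ≥ 0` (`d_j ≥ 0`). [cite: Balaban1987RG1, (1.18) p.263 (bookkeeping)] -/
theorem le_wt (hκ : 0 ≤ κ) (j : Fin (k + 1)) (Y : (domSys P M j).Dom) (hbw : 0 ≤ bw j) : bw j ≤ wt k κ bw j Y := by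
  unfold wt
  have h1 : 1 ≤ Real.exp (κ * (domSys P M j).dj Y) := Real.one_le_exp (mul_nonneg hκ ((domSys P M j).dj_nonneg Y))
  nlinarith

/-- **(R2, bound)**: on the tables `‖cv p _j Y ψ‖ ≤ b⁻¹·‖p‖` for any positive lower bound `b` of the level weights (`κ ≥ 0`); off the tables the section vanishes.
[cite: Balaban1987RG1, (1.18) p.263] -/
theorem norm_cv_le (hκ : 0 ≤ κ) {b : ℝ} (hb : 0 < b) (hbw : ∀ j, b ≤ bw j) (p : Pot k sp) (j : Fin (k + 1)) (Y : (domSys P M j).Dom)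
    (ψ : CPair P 𝔸) : ‖cv κ bw p j Y ψ‖ ≤ b⁻¹ * ‖p‖ := by
  rw [cv_apply, norm_mul, norm_inv, Complex.norm_real]
  have hwt : b ≤ wt k κ bw j Y := (hbw j).trans (le_wt κ bw hκ j Y (hb.le.trans (hbw j)))
  have hwt0 : 0 < wt k κ bw j Y := hb.trans_le hwt
  rw [Real.norm_of_nonneg hwt0.le]
  have hg : ‖germ ((p : lp (fun _ : TIdx k sp => ℂ) ∞) : TIdx k sp → ℂ) j Y ψ‖ ≤ ‖p‖ := by
    by_cases h : ψ ∈ sp j Y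
    · rw [germ_of_mem _ j Y h]
      exact lp.norm_apply_le_norm ENNReal.top_ne_zero (p : lp (fun _ : TIdx k sp => ℂ) ∞) ⟨j, Y, ⟨ψ, h⟩⟩
    · have h0 : germ ((p : lp (fun _ : TIdx k sp => ℂ) ∞) : TIdx k sp → ℂ) j Y ψ = 0 := by simp only [germ, dif_neg h]
      rw [h0, norm_zero]; exact norm_nonneg _
  calc (wt k κ bw j Y)⁻¹ * ‖germ ((p : lp (fun _ : TIdx k sp => ℂ) ∞) : TIdx k sp → ℂ) j Y ψ‖ ≤ (wt k κ bw j Y)⁻¹ * ‖p‖ :=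
        mul_le_mul_of_nonneg_left hg (inv_nonneg.2 hwt0.le)
    _ ≤ b⁻¹ * ‖p‖ := mul_le_mul_of_nonneg_right (inv_anti₀ hb hwt) (norm_nonneg _)

end Section

/-! ## §3 The reading `ρ : OlderTerms → Pot` — (R1), (AR-adm), (AR-dom₁), (AR-dom₂) as theorems -/
section Reading

variable [NormedRing 𝔸] [NormedAlgebra ℂ 𝔸]

/-- The weighted table of an admissible family ([I] §1's class `AdmHist sp E₀ r₁ k`, `κ ≤ r₁`, `0 ≤ E₀`, weights `0 ≤ bw ≤ Bw`) is BOUNDED by `Bw·E₀` entrywise.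
[cite: Balaban1987RG1, (1.18) p.263] -/
theorem norm_table_le_of_admHist {E₀ r₁ Bw : ℝ} (hκ : κ ≤ r₁) (hE₀ : 0 ≤ E₀) (hbw0 : ∀ j, 0 ≤ bw j) (hbw : ∀ j, bw j ≤ Bw)
    {old : OlderTerms P 𝔸 M k} (hold : old ∈ AdmHist sp E₀ r₁ k) (i : TIdx k sp) : ‖table sp κ bw old i‖ ≤ Bw * E₀ := by
  obtain ⟨j, Y, ψ⟩ := i
  have hd : 0 ≤ (domSys P M j).dj Y := (domSys P M j).dj_nonneg Y
  have h1 := hold.1 j Y ψ.1 ψ.2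
  unfold table wt
  rw [norm_mul, Complex.norm_real, Real.norm_of_nonneg (mul_nonneg (hbw0 j) (Real.exp_pos _).le)]
  calc bw j * Real.exp (κ * (domSys P M j).dj Y) * ‖old j Y ψ.1‖
      ≤ bw j * Real.exp (κ * (domSys P M j).dj Y) * (E₀ * Real.exp (-(r₁ * (domSys P M j).dj Y))) :=
        mul_le_mul_of_nonneg_left h1 (mul_nonneg (hbw0 j) (Real.exp_pos _).le)
    _ = bw j * E₀ * Real.exp ((κ - r₁) * (domSys P M j).dj Y) := by
        rw [show (κ - r₁) * (domSys P M j).dj Y = κ * (domSys P M j).dj Y + -(r₁ * (domSys P M j).dj Y) by ring, Real.exp_add]; ring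
    _ ≤ bw j * E₀ * 1 := by
        refine mul_le_mul_of_nonneg_left ?_ (mul_nonneg (hbw0 j) hE₀)
        exact Real.exp_le_one_iff.2 (mul_nonpos_of_nonpos_of_nonneg (by linarith) hd)
    _ ≤ Bw * E₀ := by rw [mul_one]; exact mul_le_mul_of_nonneg_right (hbw j) hE₀

/-- The weighted table of an admissible family is in `ℓ^∞`. [cite: Balaban1987RG1, (1.18) p.263] -/
theorem memℓp_table_of_admHist {E₀ r₁ Bw : ℝ} (hκ : κ ≤ r₁) (hE₀ : 0 ≤ E₀) (hbw0 : ∀ j, 0 ≤ bw j) (hbw : ∀ j, bw j ≤ Bw)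
    {old : OlderTerms P 𝔸 M k} (hold : old ∈ AdmHist sp E₀ r₁ k) : Memℓp (table sp κ bw old) ∞ :=
  memℓp_infty ⟨Bw * E₀, by rintro _ ⟨i, rfl⟩; exact norm_table_le_of_admHist κ bw hκ hE₀ hbw0 hbw hold i⟩

/-- The germs of the weighted table of an admissible family are ANALYTIC ON THE (open) TABLES (they agree there with `b_j e^{κ d_j(Y)}·E^{(j)}(Y; ·)`).
[cite: Balaban1987RG1, §1 p.263] -/
theorem analyticOnNhd_germ_table_of_admHist (hsp : ∀ (j : ℕ) (Y : (domSys P M j).Dom), IsOpen (sp j Y)) {E₀ r₁ : ℝ} {old : OlderTerms P 𝔸 M k}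
    (hold : old ∈ AdmHist sp E₀ r₁ k) (j : Fin (k + 1)) (Y : (domSys P M j).Dom) :
    AnalyticOnNhd ℂ (germ (table sp κ bw old) j Y) (sp j Y) := by
  have han : AnalyticOnNhd ℂ (fun ψ => ((wt k κ bw j Y : ℝ) : ℂ) * old j Y ψ) (sp j Y) := analyticOnNhd_const.mul (hold.2 j Y)
  refine han.congr (hsp j Y) fun ψ hψ => ?_
  show ((wt k κ bw j Y : ℝ) : ℂ) * old j Y ψ = germ (table sp κ bw old) j Y ψ
  rw [germ_of_mem _ j Y hψ]
  rfl

variable (sp) in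
open Classical in
/-- **THE READING `ρ`**: the weighted table of the family as an element of the germ space when it is bounded and table-analytic (e.g. on [I] §1's admissible
class), the junk value `0` otherwise. [cite: Balaban1987RG1, §1 p.263 with (1.18); Balaban1988RG2Cluster, (1.41) p.11] -/
def ρ (old : OlderTerms P 𝔸 M k) : Pot k sp :=
  if h : Memℓp (table sp κ bw old) ∞ ∧
      ∀ (j : Fin (k + 1)) (Y : (domSys P M j).Dom), AnalyticOnNhd ℂ (germ (table sp κ bw old) j Y) (sp j Y) then
    ⟨⟨table sp κ bw old, h.1⟩, fun j Y => h.2 j Y⟩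
  else 0

/-- **ON THE ADMISSIBLE CLASS THE READING IS THE WEIGHTED TABLE** (entrywise). [cite: Balaban1987RG1, §1 p.263 with (1.18)] -/
theorem coe_ρ_of_admHist (hsp : ∀ (j : ℕ) (Y : (domSys P M j).Dom), IsOpen (sp j Y)) {E₀ r₁ Bw : ℝ} (hκ : κ ≤ r₁) (hE₀ : 0 ≤ E₀)
    (hbw0 : ∀ j, 0 ≤ bw j) (hbw : ∀ j, bw j ≤ Bw) {old : OlderTerms P 𝔸 M k} (hold : old ∈ AdmHist sp E₀ r₁ k) :
    ((ρ sp κ bw old : lp (fun _ : TIdx k sp => ℂ) ∞) : TIdx k sp → ℂ) = table sp κ bw old := by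
  have h : Memℓp (table sp κ bw old) ∞ ∧
      ∀ (j : Fin (k + 1)) (Y : (domSys P M j).Dom), AnalyticOnNhd ℂ (germ (table sp κ bw old) j Y) (sp j Y) :=
    ⟨memℓp_table_of_admHist κ bw hκ hE₀ hbw0 hbw hold, analyticOnNhd_germ_table_of_admHist κ bw hsp hold⟩
  unfold ρ
  rw [dif_pos h]

/-- ★ **(R1): THE SECTION REPRODUCES AN ADMISSIBLE FAMILY ON THE TABLES** (positive level weights). [cite: Balaban1987RG1, §1 p.263 with (1.18); Balaban1988RG2Cluster, (1.41) p.11] -/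
theorem cv_ρ_eqOn_of_admHist (hsp : ∀ (j : ℕ) (Y : (domSys P M j).Dom), IsOpen (sp j Y)) {E₀ r₁ Bw : ℝ} (hκ : κ ≤ r₁) (hE₀ : 0 ≤ E₀)
    (hbwpos : ∀ j, 0 < bw j) (hbw : ∀ j, bw j ≤ Bw) {old : OlderTerms P 𝔸 M k} (hold : old ∈ AdmHist sp E₀ r₁ k)
    (j : Fin (k + 1)) (Y : (domSys P M j).Dom) : EqOn (cv κ bw (ρ sp κ bw old) j Y) (old j Y) (sp j Y) := by
  intro ψ hψ
  rw [cv_apply, coe_ρ_of_admHist κ bw hsp hκ hE₀ (fun j => (hbwpos j).le) hbw hold, germ_of_mem _ j Y hψ]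
  have hwt : (((wt k κ bw j Y : ℝ) : ℂ)) ≠ 0 := by
    have : 0 < wt k κ bw j Y := mul_pos (hbwpos j) (Real.exp_pos _)
    exact_mod_cast this.ne'
  show (((wt k κ bw j Y : ℝ) : ℂ))⁻¹ * ((((wt k κ bw j Y : ℝ) : ℂ)) * old j Y ψ) = old j Y ψ
  rw [← mul_assoc, inv_mul_cancel₀ hwt, one_mul]

/-- ★ **(AR-adm): THE READING OF AN ADMISSIBLE FAMILY HAS NORM AT MOST `Bw·E₀`** (the sup norm of the weighted table). [cite: Balaban1987RG1, (1.18) p.263] -/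
theorem norm_ρ_le_of_admHist (hsp : ∀ (j : ℕ) (Y : (domSys P M j).Dom), IsOpen (sp j Y)) {E₀ r₁ Bw : ℝ} (hκ : κ ≤ r₁) (hE₀ : 0 ≤ E₀)
    (hbw0 : ∀ j, 0 ≤ bw j) (hbw : ∀ j, bw j ≤ Bw) (hBw : 0 ≤ Bw) {old : OlderTerms P 𝔸 M k} (hold : old ∈ AdmHist sp E₀ r₁ k) :
    ‖ρ sp κ bw old‖ ≤ Bw * E₀ := by
  rw [Submodule.coe_norm]
  refine lp.norm_le_of_forall_le (mul_nonneg hBw hE₀) fun i => ?_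
  rw [coe_ρ_of_admHist κ bw hsp hκ hE₀ hbw0 hbw hold]
  exact norm_table_le_of_admHist κ bw hκ hE₀ hbw0 hbw hold i

/-- ★ **(AR-dom₁): ENTRYWISE WEIGHTED DOMINATION OF A DIFFERENCE OF ADMISSIBLE FAMILIES ⟹ NORM DOMINATION OF THE READINGS** — `‖ρ o − ρ o′‖ ≤ B` as soon as
`b_j·(e^{κ d_j(Y)}·‖o_j(Y; ψ) − o′_j(Y; ψ)‖) ≤ B` at every table point (the sup norm). [cite: Balaban1987RG1, (1.18) p.263] -/
theorem norm_ρ_sub_ρ_le (hsp : ∀ (j : ℕ) (Y : (domSys P M j).Dom), IsOpen (sp j Y)) {E₀ r₁ Bw : ℝ} (hκ : κ ≤ r₁) (hE₀ : 0 ≤ E₀)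
    (hbw0 : ∀ j, 0 ≤ bw j) (hbw : ∀ j, bw j ≤ Bw) {o o' : OlderTerms P 𝔸 M k} (ho : o ∈ AdmHist sp E₀ r₁ k) (ho' : o' ∈ AdmHist sp E₀ r₁ k)
    {B : ℝ} (hB : 0 ≤ B)
    (h : ∀ (j : Fin (k + 1)) (Y : (domSys P M j).Dom), ∀ ψ ∈ sp j Y, bw j * (Real.exp (κ * (domSys P M j).dj Y) * ‖o j Y ψ - o' j Y ψ‖) ≤ B) :
    ‖ρ sp κ bw o - ρ sp κ bw o'‖ ≤ B := by
  rw [Submodule.coe_norm, Submodule.coe_sub]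
  refine lp.norm_le_of_forall_le hB fun i => ?_
  rw [lp.coeFn_sub, Pi.sub_apply, coe_ρ_of_admHist κ bw hsp hκ hE₀ hbw0 hbw ho, coe_ρ_of_admHist κ bw hsp hκ hE₀ hbw0 hbw ho']
  obtain ⟨j, Y, ψ⟩ := i
  have hw : 0 ≤ wt k κ bw j Y := mul_nonneg (hbw0 j) (Real.exp_pos _).le
  show ‖((wt k κ bw j Y : ℝ) : ℂ) * o j Y ψ.1 - ((wt k κ bw j Y : ℝ) : ℂ) * o' j Y ψ.1‖ ≤ B
  rw [← mul_sub, norm_mul, Complex.norm_real, Real.norm_of_nonneg hw]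
  unfold wt
  rw [mul_assoc]
  exact h j Y ψ.1 ψ.2

/-- ★ **(AR-dom₂): ENTRYWISE WEIGHTED DOMINATION OF A SECOND DIFFERENCE OF ADMISSIBLE FAMILIES ⟹ NORM DOMINATION** — `‖ρ o₁ − 2ρ o₂ + ρ o₃‖ ≤ B` as soon as
`b_j·(e^{κ d_j(Y)}·‖o₁ − 2o₂ + o₃‖_j(Y; ψ)) ≤ B` at every table point. [cite: Balaban1987RG1, (1.18) p.263] -/
theorem norm_ρ_threePoint_le (hsp : ∀ (j : ℕ) (Y : (domSys P M j).Dom), IsOpen (sp j Y)) {E₀ r₁ Bw : ℝ} (hκ : κ ≤ r₁) (hE₀ : 0 ≤ E₀)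
    (hbw0 : ∀ j, 0 ≤ bw j) (hbw : ∀ j, bw j ≤ Bw) {o₁ o₂ o₃ : OlderTerms P 𝔸 M k} (h₁ : o₁ ∈ AdmHist sp E₀ r₁ k) (h₂ : o₂ ∈ AdmHist sp E₀ r₁ k)
    (h₃ : o₃ ∈ AdmHist sp E₀ r₁ k) {B : ℝ} (hB : 0 ≤ B)
    (h : ∀ (j : Fin (k + 1)) (Y : (domSys P M j).Dom), ∀ ψ ∈ sp j Y,
      bw j * (Real.exp (κ * (domSys P M j).dj Y) * ‖o₁ j Y ψ - 2 * o₂ j Y ψ + o₃ j Y ψ‖) ≤ B) :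
    ‖ρ sp κ bw o₁ - (2 : ℂ) • ρ sp κ bw o₂ + ρ sp κ bw o₃‖ ≤ B := by
  rw [Submodule.coe_norm, Submodule.coe_add, Submodule.coe_sub, Submodule.coe_smul]
  refine lp.norm_le_of_forall_le hB fun i => ?_
  rw [lp.coeFn_add, lp.coeFn_sub, lp.coeFn_smul, Pi.add_apply, Pi.sub_apply, Pi.smul_apply,
    coe_ρ_of_admHist κ bw hsp hκ hE₀ hbw0 hbw h₁, coe_ρ_of_admHist κ bw hsp hκ hE₀ hbw0 hbw h₂, coe_ρ_of_admHist κ bw hsp hκ hE₀ hbw0 hbw h₃]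
  obtain ⟨j, Y, ψ⟩ := i
  have hw : 0 ≤ wt k κ bw j Y := mul_nonneg (hbw0 j) (Real.exp_pos _).le
  show ‖((wt k κ bw j Y : ℝ) : ℂ) * o₁ j Y ψ.1 - (2 : ℂ) • (((wt k κ bw j Y : ℝ) : ℂ) * o₂ j Y ψ.1) + ((wt k κ bw j Y : ℝ) : ℂ) * o₃ j Y ψ.1‖ ≤ B
  have e : ((wt k κ bw j Y : ℝ) : ℂ) * o₁ j Y ψ.1 - (2 : ℂ) • (((wt k κ bw j Y : ℝ) : ℂ) * o₂ j Y ψ.1) + ((wt k κ bw j Y : ℝ) : ℂ) * o₃ j Y ψ.1 =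
      ((wt k κ bw j Y : ℝ) : ℂ) * (o₁ j Y ψ.1 - 2 * o₂ j Y ψ.1 + o₃ j Y ψ.1) := by
    rw [smul_eq_mul]; ring
  rw [e, norm_mul, Complex.norm_real, Real.norm_of_nonneg hw]
  unfold wt
  rw [mul_assoc]
  exact h j Y ψ.1 ψ.2

/-! ## §4 The domination rows in the Summit-side index form (levels `k′ + 1`, `k′ < k`; level `0` carries no table) -/

/-- (AR-dom₁) IN THE INDEX FORM OF THE SUMMIT-SIDE ROW `hρ₁`: with NO level-`0` table (`sp 0 Y = ∅`: level `0` carries no term, [I] (0.23)), domination of the weighted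
first differences at the levels `k′ + 1`, `k′ < k`, gives `‖ρ o − ρ o′‖ ≤ B`. [cite: Balaban1987RG1, (1.18) p.263 and (0.23) p.256] -/
theorem norm_ρ_sub_ρ_le_succ (hsp : ∀ (j : ℕ) (Y : (domSys P M j).Dom), IsOpen (sp j Y)) (hsp0 : ∀ (Y : (domSys P M 0).Dom), sp 0 Y = ∅)
    {E₀ r₁ Bw : ℝ} (hκ : κ ≤ r₁) (hE₀ : 0 ≤ E₀) (hbw0 : ∀ j, 0 ≤ bw j) (hbw : ∀ j, bw j ≤ Bw) {o o' : OlderTerms P 𝔸 M k}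
    (ho : o ∈ AdmHist sp E₀ r₁ k) (ho' : o' ∈ AdmHist sp E₀ r₁ k) {B : ℝ} (hB : 0 ≤ B)
    (h : ∀ (k' : ℕ) (hk' : k' < k) (Y : (domSys P M (k' + 1)).Dom), ∀ ψ ∈ sp (k' + 1) Y,
      bw ⟨k' + 1, Nat.succ_lt_succ hk'⟩ *
        (Real.exp (κ * (domSys P M (k' + 1)).dj Y) * ‖o ⟨k' + 1, Nat.succ_lt_succ hk'⟩ Y ψ - o' ⟨k' + 1, Nat.succ_lt_succ hk'⟩ Y ψ‖) ≤ B) :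
    ‖ρ sp κ bw o - ρ sp κ bw o'‖ ≤ B := by
  refine norm_ρ_sub_ρ_le κ bw hsp hκ hE₀ hbw0 hbw ho ho' hB fun j Y ψ hψ => ?_
  rcases Fin.eq_zero_or_eq_succ j with rfl | ⟨j', rfl⟩
  · exact absurd hψ (by simp [hsp0])
  · exact h j'.1 j'.2 Y ψ hψ

/-- (AR-dom₂) IN THE INDEX FORM OF THE SUMMIT-SIDE ROW `hρ₂`: with NO level-`0` table, domination of the weighted second differences at the levels `k′ + 1`, `k′ < k`,
gives `‖ρ o₁ − 2ρ o₂ + ρ o₃‖ ≤ B`. [cite: Balaban1987RG1, (1.18) p.263 and (0.23) p.256] -/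
theorem norm_ρ_threePoint_le_succ (hsp : ∀ (j : ℕ) (Y : (domSys P M j).Dom), IsOpen (sp j Y)) (hsp0 : ∀ (Y : (domSys P M 0).Dom), sp 0 Y = ∅)
    {E₀ r₁ Bw : ℝ} (hκ : κ ≤ r₁) (hE₀ : 0 ≤ E₀) (hbw0 : ∀ j, 0 ≤ bw j) (hbw : ∀ j, bw j ≤ Bw) {o₁ o₂ o₃ : OlderTerms P 𝔸 M k}
    (h₁ : o₁ ∈ AdmHist sp E₀ r₁ k) (h₂ : o₂ ∈ AdmHist sp E₀ r₁ k) (h₃ : o₃ ∈ AdmHist sp E₀ r₁ k) {B : ℝ} (hB : 0 ≤ B)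
    (h : ∀ (k' : ℕ) (hk' : k' < k) (Y : (domSys P M (k' + 1)).Dom), ∀ ψ ∈ sp (k' + 1) Y,
      bw ⟨k' + 1, Nat.succ_lt_succ hk'⟩ *
        (Real.exp (κ * (domSys P M (k' + 1)).dj Y) *
          ‖o₁ ⟨k' + 1, Nat.succ_lt_succ hk'⟩ Y ψ - 2 * o₂ ⟨k' + 1, Nat.succ_lt_succ hk'⟩ Y ψ + o₃ ⟨k' + 1, Nat.succ_lt_succ hk'⟩ Y ψ‖) ≤ B) :
    ‖ρ sp κ bw o₁ - (2 : ℂ) • ρ sp κ bw o₂ + ρ sp κ bw o₃‖ ≤ B := by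
  refine norm_ρ_threePoint_le κ bw hsp hκ hE₀ hbw0 hbw h₁ h₂ h₃ hB fun j Y ψ hψ => ?_
  rcases Fin.eq_zero_or_eq_succ j with rfl | ⟨j', rfl⟩
  · exact absurd hψ (by simp [hsp0])
  · exact h j'.1 j'.2 Y ψ hψ

end Reading

end Literature.MathematicalPhysics.QuantumFieldTheory.Balaban1983to89.B13OlderTermsTableGerms

end
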